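import Literature.Analysis.FluidPDE.KatoLocalLerayPressureProofs
import HarnessLib

/-!
# The Riesz pressure of a Kato solution: distributional solution and suitability on slabs

Analysis/FluidPDE proof file (theorems only). For `ν > 0` and a Kato solution `u` on `[0, T)`
(`IsKatoSolutionOn T ν u₀ u`) and `0 < S < T`, the space–time Riesz pressure `p` of
`exists_spaceTime_rieszPressure` — a jointly measurable `p ∈ L^{3/2}((0,S) × ℝ³)` whose slices are
a.e. the Riesz pressures `Π[u(t)] = -Σ ℛᵢℛⱼ(uᵢuⱼ)(t)` with Stein's bound
`‖p(t)‖_{3/2} ≤ C ‖u(t)‖₃²` — makes `(u, p)` a distributional solution on the slab `(0, S) × ℝ³`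
**and** a suitable weak solution there (`IsKatoSolutionOn.exists_rieszPressure_suitable_slab`).
This is the content of the tree's `kato_distributional_slab_holds` and
`IsKatoSolutionOn.exists_suitable_slab_of_distributional` (Lemarié-Rieusset 2016, Def. 6.2 /
(6.13) / Prop. 6.5 and Thm. 15.1 (A), proof p. 565), with the pressure witness kept explicit: the
slice information is what controls the pressure far away, uniformly in `S`, on the
Calderón / Rusin–Šverák route to the far-field bound of Kato solutions
(`IsKatoSolutionOn.farField_bound`; Rusin–Šverák 2011, §4 p. 6).

## Mathlib / tree search

Tree (all used, proofs transcribed from `KatoLocalLerayPressureProofs.lean` and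
`KatoLocalLerayPressure.lean`): `exists_spaceTime_rieszPressure`,
`isDistributionalNSSolutionOn_slab_of_veryWeak`, `setIntegral_veryWeak_eq_zero_of_iterated`,
`setIntegral_pressure_laplacian_eq_of_ae_slice`, `IsKatoSolutionOn.integral_weakForm_eq_zero`,
`IsKatoSolutionOn.setIntegral_inner_gradient_eq_zero`, `IsKatoSolutionOn.memLp_three_strip`,
`locallyIntegrableOn_slab_of_memLp`, `memLp_norm_sq_of_memLp_three`,
`IsKatoSolutionOn.exists_ae_norm_le_of_pos`, `isSuitableWeakSolutionOn_of_bounded`,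
`IsSuitableWeakSolutionOn.of_exhaustion`.

## References

* P. G. Lemarié-Rieusset, *The Navier–Stokes Problem in the 21st Century*, CRC Press 2016:
  Def. 6.2, Lemma 6.3 (p. 126), Prop. 6.2 (p. 130), Prop. 6.5 / Def. 6.9 (p. 136), Thm. 15.1 (A)
  and its proof (p. 565). [LemarieRieusset2016]
* W. Rusin, V. Šverák, J. Funct. Anal. 260 (2011) = arXiv:0911.0500, §4 p. 6. [RusinSverak2011]
-/

noncomputable section

open MeasureTheory TopologicalSpace Set Function Filter Topology Metric InnerProductSpace
open scoped ENNReal NNReal RealInnerProductSpace Laplacian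

namespace Literature.Analysis.FluidPDE

variable {T S ν : ℝ} {u₀ : EuclideanSpace ℝ (Fin 3) → EuclideanSpace ℝ (Fin 3)}
  {u : ℝ → EuclideanSpace ℝ (Fin 3) → EuclideanSpace ℝ (Fin 3)}

/-- **The Riesz pressure makes a Kato solution distributional on interior slabs** (the proof of
`kato_distributional_slab_holds` with the pressure as a hypothesis): if `p` is jointly
measurable, `p ∈ L^{3/2}((0,S) × ℝ³)` and its slices solve the weak Poisson equation
`∫ p(t) Δφ = -∫ D²φ(u(t), u(t))` for a.e. `t ∈ (0, S)`, then `(u, p)` is a distributional solution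
of the unforced equations on `(0, S) × ℝ³`. [cite: LemarieRieusset2016, Def. 6.2, Lemma 6.3, (6.13), Prop. 6.5] -/
theorem IsKatoSolutionOn.distributional_slab_of_pressure (hν : 0 < ν) (hu : IsKatoSolutionOn T ν u₀ u)
    (hST : S < T) {p : ℝ → EuclideanSpace ℝ (Fin 3) → ℝ}
    (hp32 : MemLp (uncurry p) (3 / 2 : ℝ≥0∞)
      (volume.restrict (Ioo 0 S ×ˢ (univ : Set (EuclideanSpace ℝ (Fin 3))))))
    (hsl : ∀ᵐ t ∂(volume.restrict (Ioo 0 S)), ∀ φ : EuclideanSpace ℝ (Fin 3) → ℝ,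
      ContDiff ℝ (⊤ : ℕ∞) φ → HasCompactSupport φ →
        ∫ x, p t x * (Δ φ) x = -∫ x, fderiv ℝ (fderiv ℝ φ) x (u t x) (u t x)) :
    IsDistributionalNSSolutionOn (slab (EuclideanSpace ℝ (Fin 3)) (Ioo 0 S) isOpen_Ioo) ν 0 u p := by
  have huS : IsKatoSolutionOn S ν u₀ u := hu.mono hST.le
  have hu3 : MemLp (uncurry u) 3 (volume.restrict (Ioo 0 S ×ˢ (univ : Set (EuclideanSpace ℝ (Fin 3))))) :=
    hu.memLp_three_strip hST
  have hu1 : LocallyIntegrableOn (uncurry u)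
      ((slab (EuclideanSpace ℝ (Fin 3)) (Ioo 0 S) isOpen_Ioo : Opens (ℝ × EuclideanSpace ℝ (Fin 3))) :
        Set (ℝ × EuclideanSpace ℝ (Fin 3))) volume :=
    locallyIntegrableOn_slab_of_memLp hu3 (by norm_num)
  have h32 : (1 : ℝ≥0∞) ≤ 3 / 2 :=
    ((ENNReal.lt_div_iff_mul_lt (Or.inl (by norm_num)) (Or.inl (by norm_num))).2 (by norm_num)).le
  have hu2 : LocallyIntegrableOn (fun z => ‖uncurry u z‖ ^ 2)
      ((slab (EuclideanSpace ℝ (Fin 3)) (Ioo 0 S) isOpen_Ioo : Opens (ℝ × EuclideanSpace ℝ (Fin 3))) :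
        Set (ℝ × EuclideanSpace ℝ (Fin 3))) volume :=
    locallyIntegrableOn_slab_of_memLp (memLp_norm_sq_of_memLp_three hu3) h32
  have hp1 : LocallyIntegrableOn (uncurry p)
      ((slab (EuclideanSpace ℝ (Fin 3)) (Ioo 0 S) isOpen_Ioo : Opens (ℝ × EuclideanSpace ℝ (Fin 3))) :
        Set (ℝ × EuclideanSpace ℝ (Fin 3))) volume :=
    locallyIntegrableOn_slab_of_memLp hp32 h32
  refine isDistributionalNSSolutionOn_slab_of_veryWeak hu3 hp32 (fun θ hθ => ?_) (fun θ hθ => ?_)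
    (fun ψ hψ hdiv => ?_)
  · exact huS.setIntegral_inner_gradient_eq_zero hθ
  · exact setIntegral_pressure_laplacian_eq_of_ae_slice hu1 hu2 hp1 hsl hθ
  · exact setIntegral_veryWeak_eq_zero_of_iterated hu1 hu2 hψ (huS.integral_weakForm_eq_zero hν hψ hdiv)

/-- **Suitability on the slab for a given pressure** (the proof of
`IsKatoSolutionOn.exists_suitable_slab_of_distributional` with the pressure as a hypothesis;
Lemarié-Rieusset 2016, Thm. 15.1 (A), proof p. 565: "`√t u` is bounded, hence `u` is suitable"):
if `(u, p)` is a distributional solution on `(0, S) × ℝ³`, `S < T`, with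
`∫₀ˢ∫ |p|^{3/2} < ∞`, then `(u, p)` is a suitable weak solution on the slab.
[cite: LemarieRieusset2016, Thm. 15.1 (A), proof (file p. 565)] -/
theorem IsKatoSolutionOn.suitable_slab_of_pressure (hν : 0 < ν) (hu : IsKatoSolutionOn T ν u₀ u)
    (hS : 0 < S) (hST : S < T) {p : ℝ → EuclideanSpace ℝ (Fin 3) → ℝ}
    (hNS : IsDistributionalNSSolutionOn (slab (EuclideanSpace ℝ (Fin 3)) (Ioo 0 S) isOpen_Ioo) ν 0 u p)
    (hp : ∫⁻ z in Ioo 0 S ×ˢ (univ : Set (EuclideanSpace ℝ (Fin 3))), ‖p z.1 z.2‖ₑ ^ (3 / 2 : ℝ) < ∞) :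
    IsSuitableWeakSolutionOn (slab (EuclideanSpace ℝ (Fin 3)) (Ioo 0 S) isOpen_Ioo) ν 0 u p := by
  -- the exhaustion of the slab by the boxes `Ωₙ = (S/(n+2), S) × B_{n+1}(0)`
  let Qn : ℕ → Opens (ℝ × EuclideanSpace ℝ (Fin 3)) := fun n =>
    ⟨Ioo (S / (n + 2)) S ×ˢ ball (0 : EuclideanSpace ℝ (Fin 3)) (n + 1), isOpen_Ioo.prod isOpen_ball⟩
  have hQn : ∀ n, ((Qn n : Opens (ℝ × EuclideanSpace ℝ (Fin 3))) : Set (ℝ × EuclideanSpace ℝ (Fin 3))) =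
      Ioo (S / (n + 2)) S ×ˢ ball (0 : EuclideanSpace ℝ (Fin 3)) (n + 1) := fun n => rfl
  have hpos : ∀ n : ℕ, 0 < S / (n + 2) := fun n => by positivity
  have hsubn : ∀ n : ℕ, Ioo (S / (n + 2)) S ×ˢ ball (0 : EuclideanSpace ℝ (Fin 3)) (n + 1) ⊆ Ioo 0 S ×ˢ univ :=
    fun n => prod_mono (Ioo_subset_Ioo_left (hpos n).le) (subset_univ _)
  have hle : ∀ n, Qn n ≤ slab (EuclideanSpace ℝ (Fin 3)) (Ioo 0 S) isOpen_Ioo := fun n z hz => by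
    have hz' : z ∈ Ioo (S / (n + 2)) S ×ˢ ball (0 : EuclideanSpace ℝ (Fin 3)) (n + 1) := hz
    exact mem_slab.2 ⟨(hpos n).trans hz'.1.1, hz'.1.2⟩
  have hmono : Monotone Qn := by
    refine monotone_nat_of_le_succ fun n z hz => ?_
    have hz' : z ∈ Ioo (S / (n + 2)) S ×ˢ ball (0 : EuclideanSpace ℝ (Fin 3)) (n + 1) := hz
    change z ∈ Ioo (S / ((n + 1 : ℕ) + 2)) S ×ˢ ball (0 : EuclideanSpace ℝ (Fin 3)) ((n + 1 : ℕ) + 1)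
    push_cast
    refine ⟨⟨lt_of_le_of_lt ?_ hz'.1.1, hz'.1.2⟩, ball_subset_ball (by linarith) hz'.2⟩
    exact div_le_div_of_nonneg_left hS.le (by positivity) (by linarith)
  have hcov : ∀ K ⊆ ((slab (EuclideanSpace ℝ (Fin 3)) (Ioo 0 S) isOpen_Ioo : Opens (ℝ × EuclideanSpace ℝ (Fin 3))) :
      Set (ℝ × EuclideanSpace ℝ (Fin 3))), IsCompact K → ∃ n, K ⊆ (Qn n : Set (ℝ × EuclideanSpace ℝ (Fin 3))) := by
    intro K hK hKc
    rcases K.eq_empty_or_nonempty with rfl | hne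
    · exact ⟨0, empty_subset _⟩
    obtain ⟨zmin, hzminK, hzmin⟩ := hKc.exists_isMinOn hne continuous_fst.continuousOn
    have ha : 0 < zmin.1 := (mem_slab.1 (hK hzminK)).1
    obtain ⟨R, -, hR⟩ := (hKc.image continuous_snd).isBounded.subset_ball_lt 0 (0 : EuclideanSpace ℝ (Fin 3))
    obtain ⟨n, hn⟩ := exists_nat_gt (max (S / zmin.1) R)
    have hn1 : S / zmin.1 < n := (le_max_left _ _).trans_lt hn
    have hn2 : R < n := (le_max_right _ _).trans_lt hn
    refine ⟨n, fun z hz => ?_⟩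
    rw [hQn]
    refine ⟨⟨?_, (mem_slab.1 (hK hz)).2⟩, ?_⟩
    · have h1 : zmin.1 ≤ z.1 := hzmin hz
      have h2 : S / (n + 2) < zmin.1 := by
        rw [div_lt_iff₀ (by positivity)]
        rw [div_lt_iff₀ ha] at hn1
        nlinarith
      exact h2.trans_le h1
    · have hz2 : z.2 ∈ ball (0 : EuclideanSpace ℝ (Fin 3)) R := hR (mem_image_of_mem _ hz)
      exact ball_subset_ball (by linarith) hz2
  refine IsSuitableWeakSolutionOn.of_exhaustion hle hmono hcov fun n => ?_
  -- on each box: finite measure, `u` bounded, `p ∈ L^{3/2}`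
  have hvol : volume ((Qn n : Opens (ℝ × EuclideanSpace ℝ (Fin 3))) : Set (ℝ × EuclideanSpace ℝ (Fin 3))) < ∞ := by
    rw [hQn, show (volume : Measure (ℝ × EuclideanSpace ℝ (Fin 3))) =
      (volume : Measure ℝ).prod (volume : Measure (EuclideanSpace ℝ (Fin 3))) from rfl, Measure.prod_prod]
    exact ENNReal.mul_lt_top measure_Ioo_lt_top measure_ball_lt_top
  obtain ⟨M, hM⟩ := hu.exists_ae_norm_le_of_pos hν (hpos n) hST
  have hM' : ∀ᵐ z ∂(volume.restrict ((Qn n : Opens (ℝ × EuclideanSpace ℝ (Fin 3))) :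
      Set (ℝ × EuclideanSpace ℝ (Fin 3)))), ‖u z.1 z.2‖ ≤ M := by
    rw [hQn]
    exact ae_restrict_of_ae_restrict_of_subset (prod_mono Subset.rfl (subset_univ _)) hM
  have hp' : ∫⁻ z in ((Qn n : Opens (ℝ × EuclideanSpace ℝ (Fin 3))) : Set (ℝ × EuclideanSpace ℝ (Fin 3))),
      ‖p z.1 z.2‖ₑ ^ (3 / 2 : ℝ) < ∞ := by
    rw [hQn]
    exact lt_of_le_of_lt (lintegral_mono_set (hsubn n)) hp
  exact isSuitableWeakSolutionOn_of_bounded hν (hNS.of_le (hle n)) hvol hM' hp'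

/-- **The Riesz pressure of a Kato solution on an interior slab, with its slices**
(Lemarié-Rieusset 2016, Prop. 6.5 / Def. 6.9 / Prop. 6.2 with Thm. 15.1 (A)): for `ν > 0`, a
Kato solution `u` on `[0, T)` and `0 < S < T` there is a pressure `p`, jointly measurable and in
`L^{3/2}((0,S) × ℝ³)` with `∫₀ˢ∫|p|^{3/2} < ∞`, whose slices are a.e. the Riesz pressures
`Π[u(t)]` and obey Stein's bound `‖p(t)‖_{3/2} ≤ C_S ‖u(t)‖₃²` for a.e. `t`, such that `(u, p)` is
a suitable weak solution of the unforced equations on the slab `(0, S) × ℝ³`.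
[cite: LemarieRieusset2016, Prop. 6.5, Def. 6.9, Prop. 6.2 (p. 130–136); Thm. 15.1 (A), proof p. 565] -/
theorem IsKatoSolutionOn.exists_rieszPressure_suitable_slab (hν : 0 < ν) (hu : IsKatoSolutionOn T ν u₀ u)
    (hS : 0 < S) (hST : S < T) :
    ∃ p : ℝ → EuclideanSpace ℝ (Fin 3) → ℝ,
      AEStronglyMeasurable (uncurry p) (volume.restrict (Ioo 0 S ×ˢ (univ : Set (EuclideanSpace ℝ (Fin 3))))) ∧
      MemLp (uncurry p) (3 / 2 : ℝ≥0∞) (volume.restrict (Ioo 0 S ×ˢ (univ : Set (EuclideanSpace ℝ (Fin 3))))) ∧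
      (∀ᵐ t ∂(volume.restrict (Ioo 0 S)),
        p t =ᵐ[volume] rieszPressure (u t) ∧ MemLp (p t) (3 / 2 : ℝ≥0∞) volume ∧
        eLpNorm (p t) (3 / 2 : ℝ≥0∞) volume ≤ steinConstThreeHalves * eLpNorm (u t) 3 volume ^ 2) ∧
      ∫⁻ z in Ioo 0 S ×ˢ (univ : Set (EuclideanSpace ℝ (Fin 3))), ‖p z.1 z.2‖ₑ ^ (3 / 2 : ℝ) < ∞ ∧
      IsSuitableWeakSolutionOn (slab (EuclideanSpace ℝ (Fin 3)) (Ioo 0 S) isOpen_Ioo) ν 0 u p := by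
  have hcont : ContinuousInLpOn (Icc 0 S) 3 u := hu.continuousInLpOn.mono (Icc_subset_Ico_right hST)
  obtain ⟨p, hpm, hp32, hsl⟩ := exists_spaceTime_rieszPressure hS hcont
  have hsl' : ∀ᵐ t ∂(volume.restrict (Ioo 0 S)), ∀ φ : EuclideanSpace ℝ (Fin 3) → ℝ, ContDiff ℝ (⊤ : ℕ∞) φ →
      HasCompactSupport φ → ∫ x, p t x * (Δ φ) x = -∫ x, fderiv ℝ (fderiv ℝ φ) x (u t x) (u t x) := by
    filter_upwards [hsl] with t ht using ht.2.2.2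
  have hNS := hu.distributional_slab_of_pressure hν hST hp32 hsl'
  have hp : ∫⁻ z in Ioo 0 S ×ˢ (univ : Set (EuclideanSpace ℝ (Fin 3))), ‖p z.1 z.2‖ₑ ^ (3 / 2 : ℝ) < ∞ := by
    have h32ne : (3 / 2 : ℝ≥0∞) ≠ 0 := by norm_num
    have h32top : (3 / 2 : ℝ≥0∞) ≠ ⊤ := by
      rw [ENNReal.div_eq_inv_mul]; exact ENNReal.mul_ne_top (by simp) (by simp)
    have e32 : (3 / 2 : ℝ≥0∞).toReal = 3 / 2 := by rw [ENNReal.toReal_div]; norm_num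
    have h := (eLpNorm_lt_top_iff_lintegral_rpow_enorm_lt_top h32ne h32top).1 hp32.2
    rw [e32] at h
    exact h
  refine ⟨p, hpm, hp32, ?_, hp, hu.suitable_slab_of_pressure hν hS hST hNS hp⟩
  filter_upwards [hsl] with t ht using ⟨ht.1, ht.2.1, ht.2.2.1⟩

end Literature.Analysis.FluidPDE

end
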